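import Summits.CriticalPhenomena.PercolationContinuityZ3.Theorems.SahiMasterFamilyE3FCovariance
import Summits.CriticalPhenomena.PercolationContinuityZ3.Theorems.SahiMasterFamilyFibreCubic
import HarnessLib

/-!
# The mixed two-rectangle inequality, and Kahn's `C₃` when two of the three events interact through one coordinate

Unit `prim-master-conj` (crux anchor stmt-CriticalPhenomena-4575, helper work), gen 37; memo
`run/shared/lean/prim/prim-l12/prim-master-conj/POINTWISE.md` §38 and
`run/shared/lean/prim/prim-l12/FROM-prim-master-conj-g37-PAIR-OVERLAP.md`.

Write `μ⟦X⟧ = E(1_X)` under the product weight `μ_p`.  For increasing events `a ⊆ a'`, `b ⊆ b'`, `W₀ ⊆ W₁` put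
`α = μ⟦a⟧, α' = μ⟦a'⟧, δ = α' − α, β = μ⟦b⟧, β' = μ⟦b'⟧, ε = β' − β` and

  `T_mix := 2μ⟦a∩b∩W₀⟧ + 2μ⟦a'∩b'∩W₁⟧ − α'·μ⟦b∩W₀⟧ − β'·μ⟦a∩W₀⟧ − α·μ⟦b'∩W₁⟧ − β·μ⟦a'∩W₁⟧ − δ·ε·μ⟦W₁⟧`.

* `mixedRectangle_identity` — the polynomial identity (every weight)
  `α'β'·T_mix = α'β·P₀(a|b) + αβ'·P₀(b|a) + (δβ+εα')·[P₀(a'|b) + P₀(b'|a)] + (αβ'+δε)·P₁(a'|b') + α'β·P₁(b'|a')`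
  `            + α'δε·P₁(b'|Ω) + δε·μ⟦a∩b∩W₀⟧ + (δβ+εα')·[μ⟦(a'∖a)∩(b'∖b)∩W₀⟧ + μ⟦a'∩b'∩(W₁∖W₀)⟧]`,
  where `P_i(x|y) := μ⟦x∩y∩W_i⟧ − μ⟦x⟧·μ⟦y∩W_i⟧ ≥ 0` is a Harris slack (`x` versus the increasing event `y ∩ W_i`);
* **`mixedRectangle_nonneg`** (THE MIXED TWO-RECTANGLE INEQUALITY): `T_mix ≥ 0` for increasing `a ⊆ a'`, `b ⊆ b'`,
  `W₀ ⊆ W₁` under a product measure — seven applications of Harris' inequality (`harris_ex_ind`) and the identity;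
  `twoRectangle_nonneg` — the case `W₀ = W₁`.
* **`sahiE_three_ind_nonneg_of_indepSections`** — KAHN'S CONJECTURE 5 / `C₃` FOR "PAIR-OVERLAP ≤ 1" TRIPLES: if
  `U₀, U₁, U₂` are increasing and at some coordinate `e` the `e`-sections of `U₀` and `U₁` are independent in pairs
  (`μ⟦U₀⁰∩U₁⁰⟧ = μ⟦U₀⁰⟧μ⟦U₁⁰⟧`, `μ⟦U₀¹∩U₁¹⟧ = μ⟦U₀¹⟧μ⟦U₁¹⟧`), then `E₃(μ_p; U₀,U₁,U₂) ≥ 0` for every `p`.  Indeed the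
  fibre cubic `s ↦ E₃(μ_{p[e↦s]})` has Bernstein coefficients `c₀ = D₀`, `3c₁ = T_mix + D₀ + (μ⟦W₁⟧−μ⟦W₀⟧)δε`,
  `3c₂ = T_mix + D₃`, `c₃ = D₃` with `a = U₀⁰, a' = U₀¹, b = U₁⁰, b' = U₁¹, W₀ = U₂⁰, W₁ = U₂¹`,
  `D₀ = 2μ⟦abW₀⟧ − αμ⟦bW₀⟧ − βμ⟦aW₀⟧ ≥ 0`, `D₃ = 2μ⟦a'b'W₁⟧ − α'μ⟦b'W₁⟧ − β'μ⟦a'W₁⟧ ≥ 0`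
  (`cubicE3_eq_bernstein_of_indepSections`); in particular the lineage's one-coordinate targets `L20 = 3c₁ − c₀`
  and `L21 = 3c₂ − c₃ = T_mix` are `≥ 0` in this class (POINTWISE §32–33);
  **`sahiE_three_ind_nonneg_of_supports`** — the same under the combinatorial hypothesis that `U₀`, `U₁` are
  determined by finite coordinate sets `S`, `T` with `S ∩ T ⊆ {e}` (the supports of two of the three events meet in
  at most one coordinate; the third event is arbitrary).
HONEST FRAMING: `T_mix ≥ 0` is implied by Harris; the corollary is a new (modest) certified region of Kahn's
Conjecture 5 / Sahi's `C₃` (`MasterFamilyNonneg 3`), which remains OPEN. [this work]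
-/

noncomputable section

open scoped Classical

namespace Summit.CriticalPhenomena.PercolationContinuityZ3.Theorems

namespace MixedRectangle

open Finset Function
open Literature.Combinatorics.Sahi2008
open Literature.Probability.Percolation (DeterminedBy)
open Literature.Probability.Percolation.DecisionTree (ind ind_nonneg ind_of_mem ind_of_not_mem)
open Literature.Probability.LatticeModels (prodBernoulli prodBernoulli_real_inter_of_determinedBy_disjoint)

variable {ι : Type} [Fintype ι]

local notation3 (prettyPrint := false) "μ⟦" q ", " X "⟧" => ex (bernoulliWeight q) (ind X)

/-! ### 0. Plumbing: monotonicity and inclusion–exclusion for `E(1_X)` -/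

omit [Fintype ι] in
/-- `1_X ≤ 1_Y` pointwise for `X ⊆ Y`. [folklore] -/
theorem ind_le_ind_of_subset {X Y : Set (Set ι)} (h : X ⊆ Y) (ω : Set ι) : ind X ω ≤ ind Y ω := by
  by_cases hX : ω ∈ X
  · rw [ind_of_mem hX, ind_of_mem (h hX)]
  · rw [ind_of_not_mem hX]; exact ind_nonneg Y ω

/-- `E(1_X) ≤ E(1_Y)` for `X ⊆ Y` under a nonnegative weight. [folklore] -/
theorem ex_ind_mono {μ : Set ι → ℝ} (hμ : ∀ ω, 0 ≤ μ ω) {X Y : Set (Set ι)} (h : X ⊆ Y) :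
    ex μ (ind X) ≤ ex μ (ind Y) :=
  ex_mono hμ fun ω => ind_le_ind_of_subset h ω

omit [Fintype ι] in
/-- Pointwise inclusion–exclusion on a `2 × 2` grid of nested events: for `a ⊆ a'`, `b ⊆ b'`,
`1_{a'∩b'∩W} − 1_{a∩b'∩W} − 1_{a'∩b∩W} + 1_{a∩b∩W} ≥ 0` (it is the indicator of `(a'∖a) ∩ (b'∖b) ∩ W`). [folklore] -/
theorem ind_inclExcl_nonneg {a a' b b' W : Set (Set ι)} (ha : a ⊆ a') (hb : b ⊆ b') (ω : Set ι) :
    0 ≤ ind (a' ∩ b' ∩ W) ω - ind (a ∩ b' ∩ W) ω - ind (a' ∩ b ∩ W) ω + ind (a ∩ b ∩ W) ω := by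
  by_cases hW : ω ∈ W
  · by_cases h1 : ω ∈ a
    · have h1' : ω ∈ a' := ha h1
      by_cases h2 : ω ∈ b
      · have h2' : ω ∈ b' := hb h2
        rw [ind_of_mem (Set.mem_inter (Set.mem_inter h1' h2') hW), ind_of_mem (Set.mem_inter (Set.mem_inter h1 h2') hW),
          ind_of_mem (Set.mem_inter (Set.mem_inter h1' h2) hW), ind_of_mem (Set.mem_inter (Set.mem_inter h1 h2) hW)]; norm_num
      · by_cases h2' : ω ∈ b'
        · rw [ind_of_mem (Set.mem_inter (Set.mem_inter h1' h2') hW), ind_of_mem (Set.mem_inter (Set.mem_inter h1 h2') hW),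
            ind_of_not_mem (fun h => h2 h.1.2), ind_of_not_mem (fun h => h2 h.1.2)]; norm_num
        · rw [ind_of_not_mem (fun h => h2' h.1.2), ind_of_not_mem (fun h => h2' h.1.2),
            ind_of_not_mem (fun h => h2 h.1.2), ind_of_not_mem (fun h => h2 h.1.2)]; norm_num
    · by_cases h1' : ω ∈ a'
      · by_cases h2 : ω ∈ b
        · have h2' : ω ∈ b' := hb h2
          rw [ind_of_mem (Set.mem_inter (Set.mem_inter h1' h2') hW), ind_of_not_mem (fun h => h1 h.1.1),
            ind_of_mem (Set.mem_inter (Set.mem_inter h1' h2) hW), ind_of_not_mem (fun h => h1 h.1.1)]; norm_num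
        · by_cases h2' : ω ∈ b'
          · rw [ind_of_mem (Set.mem_inter (Set.mem_inter h1' h2') hW), ind_of_not_mem (fun h => h1 h.1.1),
              ind_of_not_mem (fun h => h2 h.1.2), ind_of_not_mem (fun h => h1 h.1.1)]; norm_num
          · rw [ind_of_not_mem (fun h => h2' h.1.2), ind_of_not_mem (fun h => h1 h.1.1),
              ind_of_not_mem (fun h => h2 h.1.2), ind_of_not_mem (fun h => h1 h.1.1)]; norm_num
      · rw [ind_of_not_mem (fun h => h1' h.1.1), ind_of_not_mem (fun h => h1 h.1.1),
          ind_of_not_mem (fun h => h1' h.1.1), ind_of_not_mem (fun h => h1 h.1.1)]; norm_num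
  · rw [ind_of_not_mem (fun h => hW h.2), ind_of_not_mem (fun h => hW h.2),
      ind_of_not_mem (fun h => hW h.2), ind_of_not_mem (fun h => hW h.2)]; norm_num

/-- Inclusion–exclusion for the weight: `μ⟦a'∩b'∩W⟧ − μ⟦a∩b'∩W⟧ − μ⟦a'∩b∩W⟧ + μ⟦a∩b∩W⟧ ≥ 0` when `a ⊆ a'`,
`b ⊆ b'` (the left side is `μ⟦(a'∖a) ∩ (b'∖b) ∩ W⟧`). [folklore] -/
theorem ex_ind_inclExcl_nonneg {μ : Set ι → ℝ} (hμ : ∀ ω, 0 ≤ μ ω) {a a' b b' W : Set (Set ι)}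
    (ha : a ⊆ a') (hb : b ⊆ b') :
    0 ≤ ex μ (ind (a' ∩ b' ∩ W)) - ex μ (ind (a ∩ b' ∩ W)) - ex μ (ind (a' ∩ b ∩ W)) + ex μ (ind (a ∩ b ∩ W)) := by
  have h : ex μ (ind (a' ∩ b' ∩ W)) - ex μ (ind (a ∩ b' ∩ W)) - ex μ (ind (a' ∩ b ∩ W)) + ex μ (ind (a ∩ b ∩ W))
      = ∑ ω, μ ω * (ind (a' ∩ b' ∩ W) ω - ind (a ∩ b' ∩ W) ω - ind (a' ∩ b ∩ W) ω + ind (a ∩ b ∩ W) ω) := by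
    simp only [ex, mul_add, mul_sub, Finset.sum_add_distrib, Finset.sum_sub_distrib]
  rw [h]
  exact Finset.sum_nonneg fun ω _ => mul_nonneg (hμ ω) (ind_inclExcl_nonneg ha hb ω)

/-! ### 1. The certificate identity (every weight) -/

/-- **The seven-term certificate identity** for the mixed two-rectangle functional (pure algebra, every weight `μ`):
`α'β'·T_mix = α'β·P₀(a|b) + αβ'·P₀(b|a) + (δβ+εα')[P₀(a'|b) + P₀(b'|a)] + (αβ'+δε)P₁(a'|b') + α'β·P₁(b'|a') + α'δε·P₁(b'|Ω)`
`+ δε·μ⟦a∩b∩W₀⟧ + (δβ+εα')[(μ⟦a'b'W₀⟧ − μ⟦ab'W₀⟧ − μ⟦a'bW₀⟧ + μ⟦abW₀⟧) + (μ⟦a'b'W₁⟧ − μ⟦a'b'W₀⟧)]`. [this work] -/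
theorem mixedRectangle_identity (μ : Set ι → ℝ) (a a' b b' W₀ W₁ : Set (Set ι)) :
    ex μ (ind a') * ex μ (ind b') *
        (2 * ex μ (ind (a ∩ b ∩ W₀)) + 2 * ex μ (ind (a' ∩ b' ∩ W₁)) - ex μ (ind a') * ex μ (ind (b ∩ W₀))
          - ex μ (ind b') * ex μ (ind (a ∩ W₀)) - ex μ (ind a) * ex μ (ind (b' ∩ W₁)) - ex μ (ind b) * ex μ (ind (a' ∩ W₁))
          - (ex μ (ind a') - ex μ (ind a)) * (ex μ (ind b') - ex μ (ind b)) * ex μ (ind W₁))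
      = ex μ (ind a') * ex μ (ind b) * (ex μ (ind (a ∩ b ∩ W₀)) - ex μ (ind a) * ex μ (ind (b ∩ W₀)))
        + ex μ (ind a) * ex μ (ind b') * (ex μ (ind (a ∩ b ∩ W₀)) - ex μ (ind b) * ex μ (ind (a ∩ W₀)))
        + ((ex μ (ind a') - ex μ (ind a)) * ex μ (ind b) + (ex μ (ind b') - ex μ (ind b)) * ex μ (ind a'))
            * ((ex μ (ind (a' ∩ b ∩ W₀)) - ex μ (ind a') * ex μ (ind (b ∩ W₀)))
              + (ex μ (ind (a ∩ b' ∩ W₀)) - ex μ (ind b') * ex μ (ind (a ∩ W₀))))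
        + (ex μ (ind a) * ex μ (ind b') + (ex μ (ind a') - ex μ (ind a)) * (ex μ (ind b') - ex μ (ind b)))
            * (ex μ (ind (a' ∩ b' ∩ W₁)) - ex μ (ind a') * ex μ (ind (b' ∩ W₁)))
        + ex μ (ind a') * ex μ (ind b) * (ex μ (ind (a' ∩ b' ∩ W₁)) - ex μ (ind b') * ex μ (ind (a' ∩ W₁)))
        + ex μ (ind a') * (ex μ (ind a') - ex μ (ind a)) * (ex μ (ind b') - ex μ (ind b))
            * (ex μ (ind (b' ∩ W₁)) - ex μ (ind b') * ex μ (ind W₁))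
        + (ex μ (ind a') - ex μ (ind a)) * (ex μ (ind b') - ex μ (ind b)) * ex μ (ind (a ∩ b ∩ W₀))
        + ((ex μ (ind a') - ex μ (ind a)) * ex μ (ind b) + (ex μ (ind b') - ex μ (ind b)) * ex μ (ind a'))
            * ((ex μ (ind (a' ∩ b' ∩ W₀)) - ex μ (ind (a ∩ b' ∩ W₀)) - ex μ (ind (a' ∩ b ∩ W₀))
                  + ex μ (ind (a ∩ b ∩ W₀)))
              + (ex μ (ind (a' ∩ b' ∩ W₁)) - ex μ (ind (a' ∩ b' ∩ W₀)))) := by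
  ring

/-! ### 2. The mixed two-rectangle inequality -/

/-- **THE MIXED TWO-RECTANGLE INEQUALITY.**  For a product weight `μ_p` and increasing events `a ⊆ a'`, `b ⊆ b'`,
`W₀ ⊆ W₁`, with `α = μ⟦a⟧, α' = μ⟦a'⟧, β = μ⟦b⟧, β' = μ⟦b'⟧`:
`2μ⟦a∩b∩W₀⟧ + 2μ⟦a'∩b'∩W₁⟧ − α'μ⟦b∩W₀⟧ − β'μ⟦a∩W₀⟧ − αμ⟦b'∩W₁⟧ − βμ⟦a'∩W₁⟧ − (α'−α)(β'−β)μ⟦W₁⟧ ≥ 0`.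
Proof: `mixedRectangle_identity`, seven Harris inequalities (`harris_ex_ind`), division by `α'β' > 0` (the
degenerate case `α'β' = 0` is direct). [this work] -/
theorem mixedRectangle_nonneg (p : ι → unitInterval) {a a' b b' W₀ W₁ : Set (Set ι)}
    (ha : IsUpperSet a) (ha' : IsUpperSet a') (hb : IsUpperSet b) (hb' : IsUpperSet b')
    (hW₀ : IsUpperSet W₀) (hW₁ : IsUpperSet W₁) (haa' : a ⊆ a') (hbb' : b ⊆ b') (hW : W₀ ⊆ W₁) :
    0 ≤ 2 * μ⟦p, a ∩ b ∩ W₀⟧ + 2 * μ⟦p, a' ∩ b' ∩ W₁⟧ - μ⟦p, a'⟧ * μ⟦p, b ∩ W₀⟧ - μ⟦p, b'⟧ * μ⟦p, a ∩ W₀⟧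
          - μ⟦p, a⟧ * μ⟦p, b' ∩ W₁⟧ - μ⟦p, b⟧ * μ⟦p, a' ∩ W₁⟧
          - (μ⟦p, a'⟧ - μ⟦p, a⟧) * (μ⟦p, b'⟧ - μ⟦p, b⟧) * μ⟦p, W₁⟧ := by
  have hμ := (isFKGMeasure_bernoulliWeight p).nonneg
  have hα0 : 0 ≤ μ⟦p, a⟧ := ex_nonneg hμ fun ω => ind_nonneg a ω
  have hβ0 : 0 ≤ μ⟦p, b⟧ := ex_nonneg hμ fun ω => ind_nonneg b ω
  have hαα' : μ⟦p, a⟧ ≤ μ⟦p, a'⟧ := ex_ind_mono hμ haa'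
  have hββ' : μ⟦p, b⟧ ≤ μ⟦p, b'⟧ := ex_ind_mono hμ hbb'
  have h1 : μ⟦p, a⟧ * μ⟦p, b ∩ W₀⟧ ≤ μ⟦p, a ∩ b ∩ W₀⟧ := by
    have h := harris_ex_ind p ha (hb.inter hW₀)
    rwa [← Set.inter_assoc] at h
  have h2 : μ⟦p, b⟧ * μ⟦p, a ∩ W₀⟧ ≤ μ⟦p, a ∩ b ∩ W₀⟧ := by
    have h := harris_ex_ind p hb (ha.inter hW₀)
    rwa [← Set.inter_assoc, Set.inter_comm b a] at h
  have h3 : μ⟦p, a'⟧ * μ⟦p, b ∩ W₀⟧ ≤ μ⟦p, a' ∩ b ∩ W₀⟧ := by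
    have h := harris_ex_ind p ha' (hb.inter hW₀)
    rwa [← Set.inter_assoc] at h
  have h4 : μ⟦p, b'⟧ * μ⟦p, a ∩ W₀⟧ ≤ μ⟦p, a ∩ b' ∩ W₀⟧ := by
    have h := harris_ex_ind p hb' (ha.inter hW₀)
    rwa [← Set.inter_assoc, Set.inter_comm b' a] at h
  have h5 : μ⟦p, a'⟧ * μ⟦p, b' ∩ W₁⟧ ≤ μ⟦p, a' ∩ b' ∩ W₁⟧ := by
    have h := harris_ex_ind p ha' (hb'.inter hW₁)
    rwa [← Set.inter_assoc] at h
  have h6 : μ⟦p, b'⟧ * μ⟦p, a' ∩ W₁⟧ ≤ μ⟦p, a' ∩ b' ∩ W₁⟧ := by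
    have h := harris_ex_ind p hb' (ha'.inter hW₁)
    rwa [← Set.inter_assoc, Set.inter_comm b' a'] at h
  have h7 : μ⟦p, b'⟧ * μ⟦p, W₁⟧ ≤ μ⟦p, b' ∩ W₁⟧ := harris_ex_ind p hb' hW₁
  have s1 : 0 ≤ μ⟦p, a ∩ b ∩ W₀⟧ := ex_nonneg hμ fun ω => ind_nonneg _ ω
  have s2 : 0 ≤ μ⟦p, a' ∩ b' ∩ W₀⟧ - μ⟦p, a ∩ b' ∩ W₀⟧ - μ⟦p, a' ∩ b ∩ W₀⟧ + μ⟦p, a ∩ b ∩ W₀⟧ :=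
    ex_ind_inclExcl_nonneg hμ haa' hbb'
  have s3 : 0 ≤ μ⟦p, a' ∩ b' ∩ W₁⟧ - μ⟦p, a' ∩ b' ∩ W₀⟧ :=
    sub_nonneg.2 (ex_ind_mono hμ (Set.inter_subset_inter_right _ hW))
  have m1 : 0 ≤ μ⟦p, a'⟧ * μ⟦p, b⟧ := mul_nonneg (hα0.trans hαα') hβ0
  have m2 : 0 ≤ μ⟦p, a⟧ * μ⟦p, b'⟧ := mul_nonneg hα0 (hβ0.trans hββ')
  have m3 : 0 ≤ (μ⟦p, a'⟧ - μ⟦p, a⟧) * μ⟦p, b⟧ + (μ⟦p, b'⟧ - μ⟦p, b⟧) * μ⟦p, a'⟧ :=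
    add_nonneg (mul_nonneg (sub_nonneg.2 hαα') hβ0) (mul_nonneg (sub_nonneg.2 hββ') (hα0.trans hαα'))
  have m4 : 0 ≤ μ⟦p, a⟧ * μ⟦p, b'⟧ + (μ⟦p, a'⟧ - μ⟦p, a⟧) * (μ⟦p, b'⟧ - μ⟦p, b⟧) :=
    add_nonneg m2 (mul_nonneg (sub_nonneg.2 hαα') (sub_nonneg.2 hββ'))
  have m5 : 0 ≤ μ⟦p, a'⟧ * (μ⟦p, a'⟧ - μ⟦p, a⟧) * (μ⟦p, b'⟧ - μ⟦p, b⟧) :=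
    mul_nonneg (mul_nonneg (hα0.trans hαα') (sub_nonneg.2 hαα')) (sub_nonneg.2 hββ')
  have m6 : 0 ≤ (μ⟦p, a'⟧ - μ⟦p, a⟧) * (μ⟦p, b'⟧ - μ⟦p, b⟧) :=
    mul_nonneg (sub_nonneg.2 hαα') (sub_nonneg.2 hββ')
  -- `α'β' · T_mix ≥ 0` by the certificate identity
  have key := mixedRectangle_identity (bernoulliWeight p) a a' b b' W₀ W₁
  have hprod : 0 ≤ μ⟦p, a'⟧ * μ⟦p, b'⟧ *
      (2 * μ⟦p, a ∩ b ∩ W₀⟧ + 2 * μ⟦p, a' ∩ b' ∩ W₁⟧ - μ⟦p, a'⟧ * μ⟦p, b ∩ W₀⟧ - μ⟦p, b'⟧ * μ⟦p, a ∩ W₀⟧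
        - μ⟦p, a⟧ * μ⟦p, b' ∩ W₁⟧ - μ⟦p, b⟧ * μ⟦p, a' ∩ W₁⟧
        - (μ⟦p, a'⟧ - μ⟦p, a⟧) * (μ⟦p, b'⟧ - μ⟦p, b⟧) * μ⟦p, W₁⟧) := by
    rw [key]
    have t1 := mul_nonneg m1 (sub_nonneg.2 h1)
    have t2 := mul_nonneg m2 (sub_nonneg.2 h2)
    have t3 := mul_nonneg m3 (add_nonneg (sub_nonneg.2 h3) (sub_nonneg.2 h4))
    have t4 := mul_nonneg m4 (sub_nonneg.2 h5)
    have t5 := mul_nonneg m1 (sub_nonneg.2 h6)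
    have t6 := mul_nonneg m5 (sub_nonneg.2 h7)
    have t7 := mul_nonneg m6 s1
    have t8 := mul_nonneg m3 (add_nonneg s2 s3)
    linarith
  -- divide by `α'β'`, the degenerate cases being direct
  by_cases hα' : μ⟦p, a'⟧ = 0
  · have hα : μ⟦p, a⟧ = 0 := le_antisymm (hα' ▸ hαα') hα0
    have e1 : μ⟦p, a ∩ b ∩ W₀⟧ = 0 := le_antisymm
      ((ex_ind_mono hμ (show a ∩ b ∩ W₀ ⊆ a from fun ω h => h.1.1)).trans hα.le) s1
    have e2 : μ⟦p, a' ∩ b' ∩ W₁⟧ = 0 := le_antisymm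
      ((ex_ind_mono hμ (show a' ∩ b' ∩ W₁ ⊆ a' from fun ω h => h.1.1)).trans hα'.le)
      (ex_nonneg hμ fun ω => ind_nonneg _ ω)
    have e3 : μ⟦p, a ∩ W₀⟧ = 0 := le_antisymm
      ((ex_ind_mono hμ (show a ∩ W₀ ⊆ a from fun ω h => h.1)).trans hα.le) (ex_nonneg hμ fun ω => ind_nonneg _ ω)
    have e4 : μ⟦p, a' ∩ W₁⟧ = 0 := le_antisymm
      ((ex_ind_mono hμ (show a' ∩ W₁ ⊆ a' from fun ω h => h.1)).trans hα'.le) (ex_nonneg hμ fun ω => ind_nonneg _ ω)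
    rw [hα, hα', e1, e2, e3, e4]; simp
  by_cases hβ' : μ⟦p, b'⟧ = 0
  · have hβ : μ⟦p, b⟧ = 0 := le_antisymm (hβ' ▸ hββ') hβ0
    have e1 : μ⟦p, a ∩ b ∩ W₀⟧ = 0 := le_antisymm
      ((ex_ind_mono hμ (show a ∩ b ∩ W₀ ⊆ b from fun ω h => h.1.2)).trans hβ.le) s1
    have e2 : μ⟦p, a' ∩ b' ∩ W₁⟧ = 0 := le_antisymm
      ((ex_ind_mono hμ (show a' ∩ b' ∩ W₁ ⊆ b' from fun ω h => h.1.2)).trans hβ'.le)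
      (ex_nonneg hμ fun ω => ind_nonneg _ ω)
    have e3 : μ⟦p, b ∩ W₀⟧ = 0 := le_antisymm
      ((ex_ind_mono hμ (show b ∩ W₀ ⊆ b from fun ω h => h.1)).trans hβ.le) (ex_nonneg hμ fun ω => ind_nonneg _ ω)
    have e4 : μ⟦p, b' ∩ W₁⟧ = 0 := le_antisymm
      ((ex_ind_mono hμ (show b' ∩ W₁ ⊆ b' from fun ω h => h.1)).trans hβ'.le) (ex_nonneg hμ fun ω => ind_nonneg _ ω)
    rw [hβ, hβ', e1, e2, e3, e4]; simp
  have hpos : 0 < μ⟦p, a'⟧ * μ⟦p, b'⟧ :=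
    mul_pos (lt_of_le_of_ne (hα0.trans hαα') (Ne.symm hα')) (lt_of_le_of_ne (hβ0.trans hββ') (Ne.symm hβ'))
  exact (mul_nonneg_iff_of_pos_left hpos).mp hprod

/-- **THE TWO-RECTANGLE INEQUALITY** (`W₀ = W₁ = W`): for increasing `a ⊆ a'`, `b ⊆ b'`, `W` under a product weight,
with `D(a,b) := 2μ⟦a∩b∩W⟧ − μ⟦a⟧μ⟦b∩W⟧ − μ⟦b⟧μ⟦a∩W⟧`, `δ = μ⟦a'⟧−μ⟦a⟧`, `ε = μ⟦b'⟧−μ⟦b⟧`: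
`D(a,b) + D(a',b') + δ·(μ⟦b'∩W⟧ − μ⟦b∩W⟧) + ε·(μ⟦a'∩W⟧ − μ⟦a∩W⟧) − δ·ε·μ⟦W⟧ ≥ 0`. [this work] -/
theorem twoRectangle_nonneg (p : ι → unitInterval) {a a' b b' W : Set (Set ι)}
    (ha : IsUpperSet a) (ha' : IsUpperSet a') (hb : IsUpperSet b) (hb' : IsUpperSet b')
    (hW : IsUpperSet W) (haa' : a ⊆ a') (hbb' : b ⊆ b') :
    0 ≤ (2 * μ⟦p, a ∩ b ∩ W⟧ - μ⟦p, a⟧ * μ⟦p, b ∩ W⟧ - μ⟦p, b⟧ * μ⟦p, a ∩ W⟧)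
          + (2 * μ⟦p, a' ∩ b' ∩ W⟧ - μ⟦p, a'⟧ * μ⟦p, b' ∩ W⟧ - μ⟦p, b'⟧ * μ⟦p, a' ∩ W⟧)
          + (μ⟦p, a'⟧ - μ⟦p, a⟧) * (μ⟦p, b' ∩ W⟧ - μ⟦p, b ∩ W⟧)
          + (μ⟦p, b'⟧ - μ⟦p, b⟧) * (μ⟦p, a' ∩ W⟧ - μ⟦p, a ∩ W⟧)
          - (μ⟦p, a'⟧ - μ⟦p, a⟧) * (μ⟦p, b'⟧ - μ⟦p, b⟧) * μ⟦p, W⟧ := by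
  have h := mixedRectangle_nonneg p ha ha' hb hb' hW hW haa' hbb' subset_rfl
  linarith

/-! ### 3. Kahn's `C₃` for triples whose first two events have independent `e`-sections -/

/-- The section moment of an indicator is the expectation of the section's indicator:
`secEx p e 1_A b = μ⟦secAt e b A⟧`. [this work] -/
theorem secEx_ind_eq (p : ι → unitInterval) (e : ι) (A : Set (Set ι)) (b : Bool) :
    secEx p e (ind A) b = μ⟦p, secAt e b A⟧ := by
  have h1 : secEx p e (ind A) b = ex (bernoulliWeight (update p e (boolParam b))) (ind A) := by
    rw [ex_update_eq]
    cases b <;> simp [boolParam]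
  rw [h1, ex_ind_update_boolParam, ex_update_eq_of_ignores p e (boolParam b) (p e) (ind_secAt_insert e b A),
    update_eq_self]

/-- **The fibre cubic in Bernstein form for independent sections.**  Let `U₀, U₁, U₂` be events, `e` a coordinate,
`a = U₀⁰, a' = U₀¹, b = U₁⁰, b' = U₁¹, W₀ = U₂⁰, W₁ = U₂¹` the `e`-sections, and suppose `μ⟦a∩b⟧ = μ⟦a⟧μ⟦b⟧`,
`μ⟦a'∩b'⟧ = μ⟦a'⟧μ⟦b'⟧`.  Then for every real `s`
`Φ(s) = (1−s)³·D₀ + s(1−s)²·(T_mix + D₀ + (μ⟦W₁⟧−μ⟦W₀⟧)δε) + s²(1−s)·(T_mix + D₃) + s³·D₃`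
(`Φ = cubicE3`, `D₀ = 2μ⟦abW₀⟧ − αμ⟦bW₀⟧ − βμ⟦aW₀⟧`, `D₃ = 2μ⟦a'b'W₁⟧ − α'μ⟦b'W₁⟧ − β'μ⟦a'W₁⟧`). [this work] -/
theorem cubicE3_eq_bernstein_of_indepSections (p : ι → unitInterval) (e : ι) (U : Fin 3 → Set (Set ι))
    (h0 : μ⟦p, secAt e false (U 0) ∩ secAt e false (U 1)⟧ = μ⟦p, secAt e false (U 0)⟧ * μ⟦p, secAt e false (U 1)⟧)
    (h1 : μ⟦p, secAt e true (U 0) ∩ secAt e true (U 1)⟧ = μ⟦p, secAt e true (U 0)⟧ * μ⟦p, secAt e true (U 1)⟧)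
    (s : ℝ) :
    cubicE3 p e (ind (U 0)) (ind (U 1)) (ind (U 2)) s =
      (1 - s) ^ 3 * (2 * μ⟦p, secAt e false (U 0) ∩ secAt e false (U 1) ∩ secAt e false (U 2)⟧
            - μ⟦p, secAt e false (U 0)⟧ * μ⟦p, secAt e false (U 1) ∩ secAt e false (U 2)⟧
            - μ⟦p, secAt e false (U 1)⟧ * μ⟦p, secAt e false (U 0) ∩ secAt e false (U 2)⟧)
      + s * (1 - s) ^ 2 *
          ((2 * μ⟦p, secAt e false (U 0) ∩ secAt e false (U 1) ∩ secAt e false (U 2)⟧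
              + 2 * μ⟦p, secAt e true (U 0) ∩ secAt e true (U 1) ∩ secAt e true (U 2)⟧
              - μ⟦p, secAt e true (U 0)⟧ * μ⟦p, secAt e false (U 1) ∩ secAt e false (U 2)⟧
              - μ⟦p, secAt e true (U 1)⟧ * μ⟦p, secAt e false (U 0) ∩ secAt e false (U 2)⟧
              - μ⟦p, secAt e false (U 0)⟧ * μ⟦p, secAt e true (U 1) ∩ secAt e true (U 2)⟧
              - μ⟦p, secAt e false (U 1)⟧ * μ⟦p, secAt e true (U 0) ∩ secAt e true (U 2)⟧
              - (μ⟦p, secAt e true (U 0)⟧ - μ⟦p, secAt e false (U 0)⟧)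
                  * (μ⟦p, secAt e true (U 1)⟧ - μ⟦p, secAt e false (U 1)⟧) * μ⟦p, secAt e true (U 2)⟧)
            + (2 * μ⟦p, secAt e false (U 0) ∩ secAt e false (U 1) ∩ secAt e false (U 2)⟧
              - μ⟦p, secAt e false (U 0)⟧ * μ⟦p, secAt e false (U 1) ∩ secAt e false (U 2)⟧
              - μ⟦p, secAt e false (U 1)⟧ * μ⟦p, secAt e false (U 0) ∩ secAt e false (U 2)⟧)
            + (μ⟦p, secAt e true (U 2)⟧ - μ⟦p, secAt e false (U 2)⟧)
                * (μ⟦p, secAt e true (U 0)⟧ - μ⟦p, secAt e false (U 0)⟧)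
                * (μ⟦p, secAt e true (U 1)⟧ - μ⟦p, secAt e false (U 1)⟧))
      + s ^ 2 * (1 - s) *
          ((2 * μ⟦p, secAt e false (U 0) ∩ secAt e false (U 1) ∩ secAt e false (U 2)⟧
              + 2 * μ⟦p, secAt e true (U 0) ∩ secAt e true (U 1) ∩ secAt e true (U 2)⟧
              - μ⟦p, secAt e true (U 0)⟧ * μ⟦p, secAt e false (U 1) ∩ secAt e false (U 2)⟧
              - μ⟦p, secAt e true (U 1)⟧ * μ⟦p, secAt e false (U 0) ∩ secAt e false (U 2)⟧
              - μ⟦p, secAt e false (U 0)⟧ * μ⟦p, secAt e true (U 1) ∩ secAt e true (U 2)⟧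
              - μ⟦p, secAt e false (U 1)⟧ * μ⟦p, secAt e true (U 0) ∩ secAt e true (U 2)⟧
              - (μ⟦p, secAt e true (U 0)⟧ - μ⟦p, secAt e false (U 0)⟧)
                  * (μ⟦p, secAt e true (U 1)⟧ - μ⟦p, secAt e false (U 1)⟧) * μ⟦p, secAt e true (U 2)⟧)
            + (2 * μ⟦p, secAt e true (U 0) ∩ secAt e true (U 1) ∩ secAt e true (U 2)⟧
              - μ⟦p, secAt e true (U 0)⟧ * μ⟦p, secAt e true (U 1) ∩ secAt e true (U 2)⟧
              - μ⟦p, secAt e true (U 1)⟧ * μ⟦p, secAt e true (U 0) ∩ secAt e true (U 2)⟧))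
      + s ^ 3 * (2 * μ⟦p, secAt e true (U 0) ∩ secAt e true (U 1) ∩ secAt e true (U 2)⟧
            - μ⟦p, secAt e true (U 0)⟧ * μ⟦p, secAt e true (U 1) ∩ secAt e true (U 2)⟧
            - μ⟦p, secAt e true (U 1)⟧ * μ⟦p, secAt e true (U 0) ∩ secAt e true (U 2)⟧) := by
  have hprod : ∀ (A B : Set (Set ι)), ind A * ind B = ind (A ∩ B) := fun A B => ind_mul_ind_eq_inter A B
  simp only [cubicE3, hprod, secEx_ind_eq, secAt_inter, h0, h1]
  ring

/-- **KAHN'S CONJECTURE 5 / SAHI'S `C₃` WHEN TWO OF THE THREE EVENTS HAVE INDEPENDENT SECTIONS AT A COORDINATE.**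
Let `U₀, U₁, U₂` be increasing events and `e` a coordinate such that the `e`-sections of `U₀` and `U₁` are
independent in pairs under `μ_p`: `μ⟦U₀⁰∩U₁⁰⟧ = μ⟦U₀⁰⟧μ⟦U₁⁰⟧` and `μ⟦U₀¹∩U₁¹⟧ = μ⟦U₀¹⟧μ⟦U₁¹⟧`.  Then
`E₃(μ_p; 1_{U₀}, 1_{U₁}, 1_{U₂}) ≥ 0`.  Proof: all four Bernstein coefficients of the fibre cubic
(`cubicE3_eq_bernstein_of_indepSections`) are nonnegative — the outer ones by two Harris inequalities each, the middle
ones by the mixed two-rectangle inequality `mixedRectangle_nonneg`. [this work] -/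
theorem sahiE_three_ind_nonneg_of_indepSections (p : ι → unitInterval) (e : ι) {U : Fin 3 → Set (Set ι)}
    (hU : ∀ j, IsUpperSet (U j))
    (h0 : μ⟦p, secAt e false (U 0) ∩ secAt e false (U 1)⟧ = μ⟦p, secAt e false (U 0)⟧ * μ⟦p, secAt e false (U 1)⟧)
    (h1 : μ⟦p, secAt e true (U 0) ∩ secAt e true (U 1)⟧ = μ⟦p, secAt e true (U 0)⟧ * μ⟦p, secAt e true (U 1)⟧) :
    0 ≤ sahiE (bernoulliWeight p) 3 (fun j => ind (U j)) := by
  have ha : IsUpperSet (secAt e false (U 0)) := isUpperSet_secAt e false (hU 0)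
  have ha' : IsUpperSet (secAt e true (U 0)) := isUpperSet_secAt e true (hU 0)
  have hb : IsUpperSet (secAt e false (U 1)) := isUpperSet_secAt e false (hU 1)
  have hb' : IsUpperSet (secAt e true (U 1)) := isUpperSet_secAt e true (hU 1)
  have hW₀ : IsUpperSet (secAt e false (U 2)) := isUpperSet_secAt e false (hU 2)
  have hW₁ : IsUpperSet (secAt e true (U 2)) := isUpperSet_secAt e true (hU 2)
  have haa' : secAt e false (U 0) ⊆ secAt e true (U 0) := secAt_false_subset_true (hU 0) e
  have hbb' : secAt e false (U 1) ⊆ secAt e true (U 1) := secAt_false_subset_true (hU 1) e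
  have hWW : secAt e false (U 2) ⊆ secAt e true (U 2) := secAt_false_subset_true (hU 2) e
  have hμ := (isFKGMeasure_bernoulliWeight p).nonneg
  -- the fibre cubic at `s = p e` is `E₃(μ_p)`
  have hE : sahiE (bernoulliWeight p) 3 (fun j => ind (U j)) =
      cubicE3 p e (ind (U 0)) (ind (U 1)) (ind (U 2)) ((p e : unitInterval) : ℝ) := by
    have h := SahiLogDerivEnd.sahiE_three_ind_update_eq p e (p e) U
    rwa [update_eq_self] at h
  rw [hE, cubicE3_eq_bernstein_of_indepSections p e U h0 h1]
  have hs0 : 0 ≤ ((p e : unitInterval) : ℝ) := (p e).2.1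
  have hs1 : ((p e : unitInterval) : ℝ) ≤ 1 := (p e).2.2
  have hT := mixedRectangle_nonneg p ha ha' hb hb' hW₀ hW₁ haa' hbb' hWW
  have hD0 : 0 ≤ 2 * μ⟦p, secAt e false (U 0) ∩ secAt e false (U 1) ∩ secAt e false (U 2)⟧
      - μ⟦p, secAt e false (U 0)⟧ * μ⟦p, secAt e false (U 1) ∩ secAt e false (U 2)⟧
      - μ⟦p, secAt e false (U 1)⟧ * μ⟦p, secAt e false (U 0) ∩ secAt e false (U 2)⟧ := by
    have h1' : μ⟦p, secAt e false (U 0)⟧ * μ⟦p, secAt e false (U 1) ∩ secAt e false (U 2)⟧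
        ≤ μ⟦p, secAt e false (U 0) ∩ secAt e false (U 1) ∩ secAt e false (U 2)⟧ := by
      have h := harris_ex_ind p ha (hb.inter hW₀)
      rwa [← Set.inter_assoc] at h
    have h2' : μ⟦p, secAt e false (U 1)⟧ * μ⟦p, secAt e false (U 0) ∩ secAt e false (U 2)⟧
        ≤ μ⟦p, secAt e false (U 0) ∩ secAt e false (U 1) ∩ secAt e false (U 2)⟧ := by
      have h := harris_ex_ind p hb (ha.inter hW₀)
      rwa [← Set.inter_assoc, Set.inter_comm (secAt e false (U 1)) (secAt e false (U 0))] at h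
    linarith
  have hD3 : 0 ≤ 2 * μ⟦p, secAt e true (U 0) ∩ secAt e true (U 1) ∩ secAt e true (U 2)⟧
      - μ⟦p, secAt e true (U 0)⟧ * μ⟦p, secAt e true (U 1) ∩ secAt e true (U 2)⟧
      - μ⟦p, secAt e true (U 1)⟧ * μ⟦p, secAt e true (U 0) ∩ secAt e true (U 2)⟧ := by
    have h1' : μ⟦p, secAt e true (U 0)⟧ * μ⟦p, secAt e true (U 1) ∩ secAt e true (U 2)⟧
        ≤ μ⟦p, secAt e true (U 0) ∩ secAt e true (U 1) ∩ secAt e true (U 2)⟧ := by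
      have h := harris_ex_ind p ha' (hb'.inter hW₁)
      rwa [← Set.inter_assoc] at h
    have h2' : μ⟦p, secAt e true (U 1)⟧ * μ⟦p, secAt e true (U 0) ∩ secAt e true (U 2)⟧
        ≤ μ⟦p, secAt e true (U 0) ∩ secAt e true (U 1) ∩ secAt e true (U 2)⟧ := by
      have h := harris_ex_ind p hb' (ha'.inter hW₁)
      rwa [← Set.inter_assoc, Set.inter_comm (secAt e true (U 1)) (secAt e true (U 0))] at h
    linarith
  have hw : 0 ≤ (μ⟦p, secAt e true (U 2)⟧ - μ⟦p, secAt e false (U 2)⟧)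
      * (μ⟦p, secAt e true (U 0)⟧ - μ⟦p, secAt e false (U 0)⟧)
      * (μ⟦p, secAt e true (U 1)⟧ - μ⟦p, secAt e false (U 1)⟧) :=
    mul_nonneg (mul_nonneg (sub_nonneg.2 (ex_ind_mono hμ hWW)) (sub_nonneg.2 (ex_ind_mono hμ haa')))
      (sub_nonneg.2 (ex_ind_mono hμ hbb'))
  have c0 := mul_nonneg (pow_nonneg (sub_nonneg.2 hs1) 3) hD0
  have c1 := mul_nonneg (mul_nonneg hs0 (pow_nonneg (sub_nonneg.2 hs1) 2)) (add_nonneg (add_nonneg hT hD0) hw)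
  have c2 := mul_nonneg (mul_nonneg (pow_nonneg hs0 2) (sub_nonneg.2 hs1)) (add_nonneg hT hD3)
  have c3 := mul_nonneg (pow_nonneg hs0 3) hD3
  linarith

/-- **`C₃` WHEN THE SUPPORTS OF TWO OF THE THREE EVENTS MEET IN AT MOST ONE COORDINATE.**  If `U₀` is determined by a
finite coordinate set `S`, `U₁` by `T`, and `S ∩ T ⊆ {e}`, then for increasing `U₀, U₁, U₂` (the third event an
arbitrary increasing event) and every `p`: `E₃(μ_p; 1_{U₀}, 1_{U₁}, 1_{U₂}) ≥ 0` — the `e`-sections of `U₀, U₁` are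
determined by the disjoint sets `S ∖ {e}`, `T ∖ {e}`, hence independent. [this work] -/
theorem sahiE_three_ind_nonneg_of_supports (p : ι → unitInterval) (e : ι) {U : Fin 3 → Set (Set ι)}
    (hU : ∀ j, IsUpperSet (U j)) {S T : Finset ι} (hS : DeterminedBy (U 0) (↑S : Set ι))
    (hT : DeterminedBy (U 1) (↑T : Set ι)) (hST : S ∩ T ⊆ {e}) :
    0 ≤ sahiE (bernoulliWeight p) 3 (fun j => ind (U j)) := by
  have hdisj : Disjoint (S.erase e) (T.erase e) := by
    rw [Finset.disjoint_left]
    intro i hiS hiT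
    have hi : i ∈ S ∩ T := Finset.mem_inter.2 ⟨Finset.mem_of_mem_erase hiS, Finset.mem_of_mem_erase hiT⟩
    exact (Finset.ne_of_mem_erase hiS) (Finset.mem_singleton.1 (hST hi))
  have hind : ∀ bb : Bool, μ⟦p, secAt e bb (U 0) ∩ secAt e bb (U 1)⟧
      = μ⟦p, secAt e bb (U 0)⟧ * μ⟦p, secAt e bb (U 1)⟧ := by
    intro bb
    rw [ex_bernoulliWeight_ind, ex_bernoulliWeight_ind, ex_bernoulliWeight_ind]
    exact prodBernoulli_real_inter_of_determinedBy_disjoint p hdisj (determinedBy_secAt e bb hS)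
      (determinedBy_secAt e bb hT) MeasurableSet.of_discrete MeasurableSet.of_discrete
  exact sahiE_three_ind_nonneg_of_indepSections p e hU (hind false) (hind true)

end MixedRectangle

end Summit.CriticalPhenomena.PercolationContinuityZ3.Theorems
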